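import Summits.QuantumFields.YangMills.Theses.FemtoCutoffLadder
import Summits.QuantumFields.YangMills.Theorems.FemtoCutoffLadderDyadicNestedUpperDeficit
import Summits.QuantumFields.YangMills.Theorems.FemtoCutoffLadderDyadicNestedUpperDirichlet
import HarnessLib

/-!
# `DyadicNestedUpper` ⟸ ONE inequality for the PULLED-BACK COARSE EXCITATION RATIO (by-name reduction, side conditions discharged)
# (crux stmt-QuantumFields-25766 of route `FemtoCutoffLadder`, LINE 1 of seat ym-idea-1 g4; rung R2b1 = RECORD-label femto gap; seat ym-line-sfw-p1 g10,
# `--supports stmt-QuantumFields-25766`)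

Sharpening of `…DyadicNestedUpperOfDeficitRG.lean`: there the hypothesis (RG) asked for SOME admissible fine trial multiplier with positive ground-state
variance and non-negative `M`-step trial value.  Here the multiplier is THE intended one — the pull-back `g = (φ₁'/φ₀') ∘ B_{2^k}` of the ratio of the
coarse top pair along the straight-transporter block map — and both side conditions are PROVED:
* `var_pullbackRatio_pos`: `Var_{Ω}(g) ≥ (c/C₀)² > 0` (`Ω ≥ c` the fine ground state, `φ₀' ≤ C₀` the coarse one): the `Ω²`-variance dominates `c²×` the
  plain variance, which is computed on the COARSE lattice by the push-forward `(B_M)_*μ = μ'` (`BlockPullback.integral_comp_blockLink`) and there dominates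
  `C₀⁻²×` the `φ₀'²`-variance `= ‖φ₁'‖² + m² ≥ 1`;
* `trialValue_nonneg`: `λ₀^M·Var − D_M(g) = ⟨ψ, K^M ψ⟩ ≥ 0` for the centred state `ψ = (g − ⟨gΩ,Ω⟩)Ω` (spectral sums are non-negative).
Hence ★★★ `dyadicNestedUpper_of_pullbackRatioRG`: `Theses.FemtoCutoffLadder.DyadicNestedUpper` follows BY NAME from the single inequality

  (RG★)  `λ₁(L')^{L'} · (λ₀(L)^M · Var_Ω(g))^{L'} ≤ e^{CΛ²} · λ₀(L')^{L'} · (λ₀(L)^M·Var_Ω(g) − D_M(g))^{L'}`,  `L = M·L'`, `M = 2^k`,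

for every matched window tower pair, the fine positive normalised ground state `Ω`, and every coarse top pair `(φ₀' > 0, φ₁')` — in Doob form
`(λ₁'/λ₀')^{L'} ≤ e^{CΛ²}(1 − q_f^{(M)})^{L'}`, `q_f^{(M)}` = the `M`-step relaxation of the coarse excitation observable under the blocked fine ground-state
chain.  This is the renormalisation-group content of 25766 and is NOT proved here.

HONEST FRAMING: a CONDITIONAL reduction on fixed lattices; R2b1 is a RECORD rung — nothing here concerns infinite volume, the continuum, or the Clay
Yang–Mills mass gap.  No definitions, no named facts, no `sorry`.  [cite: ReedSimonIV1978, Thm. XIII.1] [cite: Balaban1985Averaging]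
-/

set_option autoImplicit false

noncomputable section

open MeasureTheory Filter Topology Real
open Literature.MathematicalPhysics.QuantumFieldTheory (GaugeConfig Site Edge gaugeTransform)
open Literature.MathematicalPhysics.QuantumLattice (transport torusBlockCorner)

namespace Summit.QuantumFields.YangMills.Theorems.FemtoCutoffLadder

open Summit.QuantumFields.YangMills.Theorems.FemtoTransferGap
open Summit.QuantumFields.YangMills.Theses.FemtoCutoffLadder

variable {M L' : ℕ} [NeZero M] [NeZero L'] [NeZero (M * L')]

/-- `Ω²`-variance of a bounded multiplier as the squared norm of the centred state: `‖(g − m)Ω‖² = ‖gΩ‖² − m²` for `m = ⟨gΩ,Ω⟩`, `‖Ω‖ = 1`. [folklore] -/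
theorem l2_centred_eq {L : ℕ} [NeZero L] {g Ω : GaugeConfig 3 L FemtoTransferGap.SU2 → ℝ} (hgΩ : IsPhys (fun U => g U * Ω U)) (hΩ : IsPhys Ω)
    (hn : l2 Ω Ω = 1) :
    l2 ((fun U => g U * Ω U) + (-l2 (fun U => g U * Ω U) Ω) • Ω) ((fun U => g U * Ω U) + (-l2 (fun U => g U * Ω U) Ω) • Ω) =
      l2 (fun U => g U * Ω U) (fun U => g U * Ω U) - l2 (fun U => g U * Ω U) Ω ^ 2 := by
  rw [Deficit.l2_add_smul_add_smul hgΩ hgΩ hΩ, hn, l2_comm Ω]; ring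

/-- ★ **Non-negativity of the `M`-step trial value**: `λ₀^m·Var_Ω(g) − D_m(g) = ⟨ψ, K_β^m ψ⟩ ≥ 0` for the centred state `ψ = (g − ⟨gΩ,Ω⟩)Ω`
(`K_β^m` is a non-negative operator on physical states: its spectral sums have non-negative terms). [cite: ReedSimonIV1978, Thm. XIII.1] -/
theorem trialValue_nonneg {L : ℕ} [NeZero L] {β : ℝ} (hβ : 0 < β) {g : GaugeConfig 3 L FemtoTransferGap.SU2 → ℝ} (hgm : Measurable g) {Cg : ℝ}
    (hgb : ∀ U, |g U| ≤ Cg)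
    (hgg : ∀ (κ : Site 3 L → FemtoTransferGap.SU2) (U : GaugeConfig 3 L FemtoTransferGap.SU2), g (gaugeTransform κ U) = g U)
    (hgz : ∀ (j : Fin 3), ∀ z ∈ Subgroup.center FemtoTransferGap.SU2, ∀ U : GaugeConfig 3 L FemtoTransferGap.SU2, g (twist j z U) = g U)
    {Ω : GaugeConfig 3 L FemtoTransferGap.SU2 → ℝ} (hΩ : IsPhys Ω) (hn : l2 Ω Ω = 1) (heig : transferApply β Ω = topValue su2Rep L β • Ω)
    {m : ℕ} (hm : 1 ≤ m) :
    0 ≤ topValue su2Rep L β ^ m * (l2 (fun U => g U * Ω U) (fun U => g U * Ω U) - l2 (fun U => g U * Ω U) Ω ^ 2) -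
        (topValue su2Rep L β ^ m * l2 (fun U => g U * Ω U) (fun U => g U * Ω U) -
          l2 (fun U => g U * Ω U) ((transferApply β)^[m] (fun U => g U * Ω U))) := by
  set lam₀ := topValue su2Rep L β with hlam₀
  set φ : GaugeConfig 3 L FemtoTransferGap.SU2 → ℝ := fun U => g U * Ω U with hφdef
  have hφ : IsPhys φ := hΩ.mul_of_invariant hgm hgb hgg hgz
  set m₁ := l2 φ Ω with hm₁
  set ψ : GaugeConfig 3 L FemtoTransferGap.SU2 → ℝ := φ + (-m₁) • Ω with hψdef
  have hψ : IsPhys ψ := hφ.add (hΩ.smul (-m₁))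
  -- `⟨ψ, K^m ψ⟩ = ⟨φ,K^mφ⟩ − λ₀^m m₁²`
  have hTm' : ∀ n : ℕ, (transferApply β)^[n] (φ + (-m₁) • Ω) = (transferApply β)^[n] φ + ((-m₁) * lam₀ ^ n) • Ω := by
    intro n
    induction n with
    | zero => simp
    | succ n ih =>
      rw [Function.iterate_succ_apply', ih, transferApply_add β (isPhys_iterate_transferApply β hφ n) (hΩ.smul _), transferApply_smul, heig,
        smul_smul, Function.iterate_succ_apply', pow_succ]
      congr 1; ring_nf
  have hTm : (transferApply β)^[m] ψ = (transferApply β)^[m] φ + ((-m₁) * lam₀ ^ m) • Ω := by rw [hψdef]; exact hTm' m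
  have hKmφ : IsPhys ((transferApply β)^[m] φ) := isPhys_iterate_transferApply β hφ m
  have hsym : l2 Ω ((transferApply β)^[m] φ) = lam₀ ^ m * m₁ := by
    rw [Deficit.l2_iterate_comm hβ hφ hΩ hm, Deficit.iterate_transferApply_eigen β heig, l2_smul_left, l2_comm Ω φ, ← hm₁]
  have hiter : l2 ψ ((transferApply β)^[m] ψ) = l2 φ ((transferApply β)^[m] φ) - lam₀ ^ m * m₁ ^ 2 := by
    rw [hTm, hψdef, Deficit.l2_add_smul_add_smul hφ hKmφ hΩ, hsym, hn, ← hm₁]; ring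
  -- `⟨ψ, K^m ψ⟩ ≥ 0` by spectral sums
  have hnonneg : 0 ≤ l2 ψ ((transferApply β)^[m] ψ) := by
    obtain ⟨e, -, -, -, hsum, -⟩ := SpecSum.exists_spectral_eigenseq (L := L) hβ
    have hS := hsum ψ ψ hψ hψ 0 m (by omega)
    simp only [Function.iterate_zero, id_eq, zero_add] at hS
    refine hS.nonneg fun k => ?_
    rw [mul_assoc]
    exact mul_nonneg (pow_nonneg (levelValue_su2Rep_nonneg L hβ.le k) m) (mul_self_nonneg _)
  rw [hiter] at hnonneg
  have : lam₀ ^ m * (l2 φ φ - m₁ ^ 2) - (lam₀ ^ m * l2 φ φ - l2 φ ((transferApply β)^[m] φ)) =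
      l2 φ ((transferApply β)^[m] φ) - lam₀ ^ m * m₁ ^ 2 := by ring
  rw [this]
  exact hnonneg

/-- A bounded measurable function is integrable against the a-priori probability measure. [folklore] -/
theorem integrable_of_bounded {L : ℕ} [NeZero L] {f : GaugeConfig 3 L FemtoTransferGap.SU2 → ℝ} (hf : Measurable f) {C : ℝ} (hC : ∀ U, |f U| ≤ C) :
    Integrable f (configMeasure FemtoTransferGap.SU2 L) :=
  (integrable_const C).mono' hf.aestronglyMeasurable (ae_of_all _ fun U => by rw [Real.norm_eq_abs]; exact hC U)

/-- The centred square `(g − m)²` of a bounded measurable multiplier is bounded and measurable. [folklore] -/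
theorem centred_sq_bounded {L : ℕ} {g : GaugeConfig 3 L FemtoTransferGap.SU2 → ℝ} (hgm : Measurable g) {Cg : ℝ} (hgb : ∀ U, |g U| ≤ Cg) (m : ℝ) :
    Measurable (fun U => (g U - m) ^ 2) ∧ ∀ U, |(g U - m) ^ 2| ≤ (Cg + |m|) ^ 2 := by
  refine ⟨(hgm.sub measurable_const).pow_const 2, fun U => ?_⟩
  rw [abs_pow]
  exact pow_le_pow_left₀ (abs_nonneg _) ((abs_sub _ _).trans (add_le_add (hgb U) le_rfl)) 2

/-- `‖(g − m)η‖² = ∫ (g − m)² η²`. [folklore] -/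
theorem l2_centred_integral {L : ℕ} [NeZero L] (g η : GaugeConfig 3 L FemtoTransferGap.SU2 → ℝ) (m : ℝ) :
    l2 ((fun U => g U * η U) + (-m) • η) ((fun U => g U * η U) + (-m) • η) =
      ∫ U, (g U - m) ^ 2 * η U ^ 2 ∂(configMeasure FemtoTransferGap.SU2 L) := by
  unfold l2
  refine integral_congr_ae (ae_of_all _ fun U => ?_)
  simp only [Pi.add_apply, Pi.smul_apply, smul_eq_mul]
  ring

/-- ★ **The pulled-back ratio has positive ground-state variance**: with the fine ground state `Ω ≥ c > 0` (`‖Ω‖ = 1`), the coarse ground state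
`0 < c₀ ≤ φ₀' ≤ C₀` (`‖φ₀'‖ = 1`), `φ₁'` normalised and orthogonal to `φ₀'`, and `g = (φ₁'/φ₀') ∘ B_M`:  `Var_Ω(g) ≥ (c/C₀)²`.
Change of variables `(B_M)_*μ = μ'` (`BlockPullback.integral_comp_blockLink`). [cite: Balaban1985Averaging] -/
theorem var_pullbackRatio_ge {Ω : GaugeConfig 3 (M * L') FemtoTransferGap.SU2 → ℝ} (hΩ : IsPhys Ω) {c : ℝ} (hc : 0 < c) (hcle : ∀ U, c ≤ Ω U)
    (hn : l2 Ω Ω = 1) {φ₀ φ₁ : GaugeConfig 3 L' FemtoTransferGap.SU2 → ℝ} (hφ₀ : IsPhys φ₀) (hφ₁ : IsPhys φ₁) {c₀ C₀ : ℝ} (hc₀ : 0 < c₀)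
    (hc₀le : ∀ V, c₀ ≤ φ₀ V) (hC₀ : ∀ V, φ₀ V ≤ C₀) (hn₀ : l2 φ₀ φ₀ = 1) (hn₁ : l2 φ₁ φ₁ = 1) (horth : l2 φ₁ φ₀ = 0) :
    (c / C₀) ^ 2 ≤
      l2 (fun U : GaugeConfig 3 (M * L') FemtoTransferGap.SU2 =>
            φ₁ (fun e : Edge 3 L' => transport U (torusBlockCorner M L' e.1) (List.replicate M e.2)) /
              φ₀ (fun e : Edge 3 L' => transport U (torusBlockCorner M L' e.1) (List.replicate M e.2)) * Ω U)
         (fun U : GaugeConfig 3 (M * L') FemtoTransferGap.SU2 =>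
            φ₁ (fun e : Edge 3 L' => transport U (torusBlockCorner M L' e.1) (List.replicate M e.2)) /
              φ₀ (fun e : Edge 3 L' => transport U (torusBlockCorner M L' e.1) (List.replicate M e.2)) * Ω U) -
        l2 (fun U : GaugeConfig 3 (M * L') FemtoTransferGap.SU2 =>
            φ₁ (fun e : Edge 3 L' => transport U (torusBlockCorner M L' e.1) (List.replicate M e.2)) /
              φ₀ (fun e : Edge 3 L' => transport U (torusBlockCorner M L' e.1) (List.replicate M e.2)) * Ω U) Ω ^ 2 := by
  -- names
  set g' : GaugeConfig 3 L' FemtoTransferGap.SU2 → ℝ := fun V => φ₁ V / φ₀ V with hg'def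
  set g : GaugeConfig 3 (M * L') FemtoTransferGap.SU2 → ℝ := fun U =>
    g' (fun e : Edge 3 L' => transport U (torusBlockCorner M L' e.1) (List.replicate M e.2)) with hgdef
  obtain ⟨hg'm, ⟨Cg, hg'b⟩, hg'g, hg'z, hg'φ₀⟩ := Dirichlet.ratio_multiplier hφ₀ hφ₁ hc₀ hc₀le
  obtain ⟨hgm, hgb, hgg, hgz⟩ := Dirichlet.pullback_multiplier (M := M) (L' := L') hg'm hg'b hg'g hg'z
  have hgΩ : IsPhys (fun U => g U * Ω U) := hΩ.mul_of_invariant hgm hgb hgg hgz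
  have hg'φ : IsPhys (fun V => g' V * φ₀ V) := hφ₀.mul_of_invariant hg'm hg'b hg'g hg'z
  have hC₀pos : 0 < C₀ := hc₀.trans_le ((hc₀le fun _ => 1).trans (hC₀ fun _ => 1))
  set m₁ := l2 (fun U => g U * Ω U) Ω with hm₁
  show (c / C₀) ^ 2 ≤ l2 (fun U => g U * Ω U) (fun U => g U * Ω U) - m₁ ^ 2
  -- Var = ∫ (g − m₁)² Ω²
  have hvar : l2 (fun U => g U * Ω U) (fun U => g U * Ω U) - m₁ ^ 2 =
      ∫ U, (g U - m₁) ^ 2 * Ω U ^ 2 ∂(configMeasure FemtoTransferGap.SU2 (M * L')) := by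
    rw [← l2_centred_eq hgΩ hΩ hn, ← hm₁, l2_centred_integral]
  -- step 1 (fine): `∫ (g − m₁)² Ω² ≥ c² ∫ (g − m₁)²`
  obtain ⟨hcm, hcb⟩ := centred_sq_bounded hgm hgb m₁
  have hint0 : Integrable (fun U => (g U - m₁) ^ 2) (configMeasure FemtoTransferGap.SU2 (M * L')) := integrable_of_bounded hcm hcb
  have hint1 : Integrable (fun U => (g U - m₁) ^ 2 * Ω U ^ 2) (configMeasure FemtoTransferGap.SU2 (M * L')) := by
    have h := (hgΩ.add (hΩ.smul (-m₁))).integrable_mul (hgΩ.add (hΩ.smul (-m₁)))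
    refine h.congr (ae_of_all _ fun U => ?_)
    simp only [Pi.add_apply, Pi.smul_apply, smul_eq_mul]; ring
  have h1 : c ^ 2 * ∫ U, (g U - m₁) ^ 2 ∂(configMeasure FemtoTransferGap.SU2 (M * L')) ≤
      ∫ U, (g U - m₁) ^ 2 * Ω U ^ 2 ∂(configMeasure FemtoTransferGap.SU2 (M * L')) := by
    rw [← integral_const_mul]
    refine integral_mono (hint0.const_mul _) hint1 fun U => ?_
    have hΩU : c ^ 2 ≤ Ω U ^ 2 := pow_le_pow_left₀ hc.le (hcle U) 2
    nlinarith [sq_nonneg (g U - m₁)]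
  -- step 2: change of variables to the coarse lattice
  have h2 : ∫ U, (g U - m₁) ^ 2 ∂(configMeasure FemtoTransferGap.SU2 (M * L')) =
      ∫ V, (g' V - m₁) ^ 2 ∂(configMeasure FemtoTransferGap.SU2 L') :=
    BlockPullback.integral_comp_blockLink (M := M) (L' := L') (f := fun V => (g' V - m₁) ^ 2) ((hg'm.sub measurable_const).pow_const 2)
  -- step 3 (coarse): `C₀² ∫ (g' − m₁)² ≥ ∫ (g' − m₁)² φ₀² = 1 + m₁²`
  obtain ⟨hcm', hcb'⟩ := centred_sq_bounded hg'm hg'b m₁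
  have hint0' : Integrable (fun V => (g' V - m₁) ^ 2) (configMeasure FemtoTransferGap.SU2 L') := integrable_of_bounded hcm' hcb'
  have hint1' : Integrable (fun V => (g' V - m₁) ^ 2 * φ₀ V ^ 2) (configMeasure FemtoTransferGap.SU2 L') := by
    have h := (hg'φ.add (hφ₀.smul (-m₁))).integrable_mul (hg'φ.add (hφ₀.smul (-m₁)))
    refine h.congr (ae_of_all _ fun V => ?_)
    simp only [Pi.add_apply, Pi.smul_apply, smul_eq_mul]; ring
  have hcoarse : ∫ V, (g' V - m₁) ^ 2 * φ₀ V ^ 2 ∂(configMeasure FemtoTransferGap.SU2 L') = 1 + m₁ ^ 2 := by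
    rw [← l2_centred_integral, Deficit.l2_add_smul_add_smul hg'φ hg'φ hφ₀, hg'φ₀, hn₁, horth, l2_comm φ₀ φ₁, horth, hn₀]; ring
  have h3 : 1 + m₁ ^ 2 ≤ C₀ ^ 2 * ∫ V, (g' V - m₁) ^ 2 ∂(configMeasure FemtoTransferGap.SU2 L') := by
    rw [← hcoarse, ← integral_const_mul]
    refine integral_mono hint1' (hint0'.const_mul _) fun V => ?_
    have hφV : φ₀ V ^ 2 ≤ C₀ ^ 2 := pow_le_pow_left₀ (hc₀.le.trans (hc₀le V)) (hC₀ V) 2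
    nlinarith [sq_nonneg (g' V - m₁)]
  -- assemble: Var ≥ c² ∫(g−m₁)² = c² ∫(g'−m₁)² ≥ c² (1+m₁²)/C₀² ≥ (c/C₀)²
  rw [hvar]
  have h4 : (c / C₀) ^ 2 ≤ c ^ 2 * ∫ V, (g' V - m₁) ^ 2 ∂(configMeasure FemtoTransferGap.SU2 L') := by
    rw [div_pow, div_le_iff₀ (pow_pos hC₀pos 2)]
    nlinarith [sq_nonneg m₁, sq_nonneg c, mul_le_mul_of_nonneg_left h3 (sq_nonneg c)]
  calc (c / C₀) ^ 2 ≤ c ^ 2 * ∫ V, (g' V - m₁) ^ 2 ∂(configMeasure FemtoTransferGap.SU2 L') := h4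
    _ = c ^ 2 * ∫ U, (g U - m₁) ^ 2 ∂(configMeasure FemtoTransferGap.SU2 (M * L')) := by rw [h2]
    _ ≤ _ := h1

/-- ★★★ **`DyadicNestedUpper` from the single RG inequality (RG★) for the pulled-back coarse excitation ratio** (module docstring), conclusion = the route decl
`Theses.FemtoCutoffLadder.DyadicNestedUpper` BY NAME; the side conditions `Var > 0`, `A ≥ 0` of `…OfDeficitRG.lean` are discharged by `var_pullbackRatio_ge`,
`trialValue_nonneg`. [cite: ReedSimonIV1978, Thm. XIII.1] [cite: Balaban1985Averaging] -/
theorem dyadicNestedUpper_of_pullbackRatioRG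
    (hRG : ∃ (C lam0 : ℝ) (L0 : ℕ), 0 < lam0 ∧ ∀ lam : ℝ, 0 < lam → lam ≤ lam0 →
      ∀ (k L' : ℕ) [NeZero L'] [NeZero (2 ^ k * L')], L0 ≤ L' → ∀ β β' : ℝ,
        InFemtoWindow lam β (2 ^ k * L') → InFemtoWindow lam β' L' → luscherLambda β (2 ^ k * L') = luscherLambda β' L' →
        ∀ Ω : GaugeConfig 3 (2 ^ k * L') FemtoTransferGap.SU2 → ℝ, IsPhys Ω → ∀ c : ℝ, 0 < c → (∀ U, c ≤ Ω U) → l2 Ω Ω = 1 →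
          transferApply β Ω = topValue su2Rep (2 ^ k * L') β • Ω →
        ∀ φ₀ φ₁ : GaugeConfig 3 L' FemtoTransferGap.SU2 → ℝ, IsPhys φ₀ → IsPhys φ₁ → ∀ c₀ : ℝ, 0 < c₀ → (∀ V, c₀ ≤ φ₀ V) →
          l2 φ₀ φ₀ = 1 → l2 φ₁ φ₁ = 1 → transferApply β' φ₀ = topValue su2Rep L' β' • φ₀ →
          transferApply β' φ₁ = secondValue su2Rep L' β' • φ₁ →
          secondValue su2Rep L' β' ^ L' * (topValue su2Rep (2 ^ k * L') β ^ (2 ^ k) * (l2 (fun U : GaugeConfig 3 (2 ^ k * L') FemtoTransferGap.SU2 => φ₁ (fun e : Edge 3 L' => transport U (torusBlockCorner (2 ^ k) L' e.1) (List.replicate (2 ^ k) e.2)) / φ₀ (fun e : Edge 3 L' => transport U (torusBlockCorner (2 ^ k) L' e.1) (List.replicate (2 ^ k) e.2)) * Ω U) (fun U : GaugeConfig 3 (2 ^ k * L') FemtoTransferGap.SU2 => φ₁ (fun e : Edge 3 L' => transport U (torusBlockCorner (2 ^ k) L' e.1) (List.replicate (2 ^ k) e.2)) / φ₀ (fun e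 : Edge 3 L' => transport U (torusBlockCorner (2 ^ k) L' e.1) (List.replicate (2 ^ k) e.2)) * Ω U) - l2 (fun U : GaugeConfig 3 (2 ^ k * L') FemtoTransferGap.SU2 => φ₁ (fun e : Edge 3 L' => transport U (torusBlockCorner (2 ^ k) L' e.1) (List.replicate (2 ^ k) e.2)) / φ₀ (fun e : Edge 3 L' => transport U (torusBlockCorner (2 ^ k) L' e.1) (List.replicate (2 ^ k) e.2)) * Ω U) Ω ^ 2)) ^ L' ≤
            Real.exp (C * luscherLambda β (2 ^ k * L') ^ 2) * (topValue su2Rep L' β' ^ L' * (topValue su2Rep (2 ^ k * L') β ^ (2 ^ k) * (l2 (fun U : GaugeConfig 3 (2 ^ k * L') FemtoTransferGap.SU2 => φ₁ (fun e : Edge 3 L' => transport U (torusBlockCorner (2 ^ k) L' e.1) (List.replicate (2 ^ k) e.2)) / φ₀ (fun e : Edge 3 L' => transport U (torusBlockCorner (2 ^ k) L' e.1) (List.replicate (2 ^ k) e.2)) * Ω U) (fun U : GaugeConfig 3 (2 ^ k * L') FemtoTransferGap.SU2 => φ₁ (fun e : Edge 3 L' => transport U (torusBlockCorner (2 ^ k)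 L' e.1) (List.replicate (2 ^ k) e.2)) / φ₀ (fun e : Edge 3 L' => transport U (torusBlockCorner (2 ^ k) L' e.1) (List.replicate (2 ^ k) e.2)) * Ω U) - l2 (fun U : GaugeConfig 3 (2 ^ k * L') FemtoTransferGap.SU2 => φ₁ (fun e : Edge 3 L' => transport U (torusBlockCorner (2 ^ k) L' e.1) (List.replicate (2 ^ k) e.2)) / φ₀ (fun e : Edge 3 L' => transport U (torusBlockCorner (2 ^ k) L' e.1) (List.replicate (2 ^ k) e.2)) * Ω U) Ω ^ 2) - (topValue su2Rep (2 ^ k * L') β ^ (2 ^ k) * l2 (fun U : GaugeConfig 3 (2 ^ k * L') FemtoTransferGap.SU2 => φ₁ (fun e : Edge 3 L' => transport U (torusBlockCorner (2 ^ k) L' e.1) (List.replicate (2 ^ k) e.2)) / φ₀ (fun e : Edge 3 L' => transport U (torusBlockCorner (2 ^ k) L' e.1) (List.replicate (2 ^ k) e.2)) * Ω U) (fun U : GaugeConfig 3 (2 ^ k * L') FemtoTransferGap.SU2 => φ₁ (fun e : Edge 3 L' => transport U (torusBlockCorner (2 ^ k) L' e.1) (List.replicate (2 ^ k) e.2)) /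 φ₀ (fun e : Edge 3 L' => transport U (torusBlockCorner (2 ^ k) L' e.1) (List.replicate (2 ^ k) e.2)) * Ω U) - l2 (fun U : GaugeConfig 3 (2 ^ k * L') FemtoTransferGap.SU2 => φ₁ (fun e : Edge 3 L' => transport U (torusBlockCorner (2 ^ k) L' e.1) (List.replicate (2 ^ k) e.2)) / φ₀ (fun e : Edge 3 L' => transport U (torusBlockCorner (2 ^ k) L' e.1) (List.replicate (2 ^ k) e.2)) * Ω U) ((transferApply β)^[2 ^ k] (fun U : GaugeConfig 3 (2 ^ k * L') FemtoTransferGap.SU2 => φ₁ (fun e : Edge 3 L' => transport U (torusBlockCorner (2 ^ k) L' e.1) (List.replicate (2 ^ k) e.2)) / φ₀ (fun e : Edge 3 L' => transport U (torusBlockCorner (2 ^ k) L' e.1) (List.replicate (2 ^ k) e.2)) * Ω U)))) ^ L')) :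
    DyadicNestedUpper := by
  obtain ⟨C, lam0, L0, hlam0, hRG⟩ := hRG
  refine ⟨C, lam0, L0, hlam0, ?_⟩
  intro lam hlam hle k L' _ L _ hL0 hL β β' hW hW' hmatch
  subst hL
  have hβ : 0 < β := zero_lt_one.trans_le hW.1
  have hβ' : 0 < β' := zero_lt_one.trans_le hW'.1
  -- fine ground state, coarse top pair
  obtain ⟨Ω, θ, c, hΩ, hc, hcle, hn, heig, -, -, -⟩ := PhysL2.exists_groundState (L := 2 ^ k * L') β
  obtain ⟨φ₀, θ', c₀, hφ₀, hc₀, hc₀le, hn₀, heig₀, -, -, -⟩ := PhysL2.exists_groundState (L := L') β'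
  obtain ⟨e, he, hon, heige⟩ := exists_isPhys_eigenfamily_of_pos (L := L') hβ' 1
  set φ₁ : GaugeConfig 3 L' FemtoTransferGap.SU2 → ℝ := e 1 with hφ₁def
  have hφ₁ : IsPhys φ₁ := he 1
  have hn₁ : l2 φ₁ φ₁ = 1 := by simpa using hon 1 1
  have heig₁ : transferApply β' φ₁ = secondValue su2Rep L' β' • φ₁ := by
    have h := heige 1
    rwa [show ((1 : Fin 2) : ℕ) = 1 from rfl, levelValue_one] at h
  obtain ⟨C₀, hC₀⟩ := hφ₀.bounded
  have hC₀' : ∀ V, φ₀ V ≤ C₀ := fun V => (le_abs_self _).trans (hC₀ V)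
  have horth : l2 φ₁ φ₀ = 0 :=
    Dirichlet.l2_eq_zero_of_eigen_ne β' hφ₁ hφ₀ heig₁ heig₀ (PhysL2.secondValue_lt_topValue β').ne
  -- the hypothesis at this data
  have hineq := hRG lam hlam hle k L' hL0 β β' hW hW' hmatch Ω hΩ c hc hcle hn heig φ₀ φ₁ hφ₀ hφ₁ c₀ hc₀ hc₀le hn₀ hn₁ heig₀ heig₁
  -- admissibility of the pulled-back ratio, side conditions
  obtain ⟨hg'm, ⟨Cg, hg'b⟩, hg'g, hg'z, -⟩ := Dirichlet.ratio_multiplier hφ₀ hφ₁ hc₀ hc₀le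
  obtain ⟨hgm, hgb, hgg, hgz⟩ := Dirichlet.pullback_multiplier (M := 2 ^ k) (L' := L') hg'm hg'b hg'g hg'z
  have hVar := var_pullbackRatio_ge (M := 2 ^ k) hΩ hc hcle hn hφ₀ hφ₁ hc₀ hc₀le hC₀' hn₀ hn₁ horth
  have hC₀pos : 0 < C₀ := hc₀.trans_le ((hc₀le fun _ => 1).trans (hC₀' fun _ => 1))
  have hVpos : 0 < (l2 (fun U : GaugeConfig 3 (2 ^ k * L') FemtoTransferGap.SU2 => φ₁ (fun e : Edge 3 L' => transport U (torusBlockCorner (2 ^ k) L' e.1) (List.replicate (2 ^ k) e.2)) / φ₀ (fun e : Edge 3 L' => transport U (torusBlockCorner (2 ^ k) L' e.1) (List.replicate (2 ^ k) e.2)) * Ω U) (fun U : GaugeConfig 3 (2 ^ k * L') FemtoTransferGap.SU2 => φ₁ (fun e : Edge 3 L' => transport U (torusBlockCorner (2 ^ k) L' e.1) (List.replicate (2 ^ k) e.2)) / φ₀ (fun e : Edge 3 L' => transport U (torusBlockCorner (2 ^ k) L' e.1) (List.replicate (2 ^ k) e.2)) * Ω U) - l2 (fun U : GaugeConfig 3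 (2 ^ k * L') FemtoTransferGap.SU2 => φ₁ (fun e : Edge 3 L' => transport U (torusBlockCorner (2 ^ k) L' e.1) (List.replicate (2 ^ k) e.2)) / φ₀ (fun e : Edge 3 L' => transport U (torusBlockCorner (2 ^ k) L' e.1) (List.replicate (2 ^ k) e.2)) * Ω U) Ω ^ 2) := lt_of_lt_of_le (by positivity) hVar
  have hA := trialValue_nonneg hβ hgm hgb hgg hgz hΩ hn heig (m := 2 ^ k) Nat.one_le_two_pow
  have hdef := Deficit.pow_secondValue_ge_deficit hβ hgm hgb hgg hgz hΩ hn heig (m := 2 ^ k) Nat.one_le_two_pow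
  -- names for the chain
  set lam₀ := topValue su2Rep (2 ^ k * L') β with hlam₀
  set lam₁ := secondValue su2Rep (2 ^ k * L') β with hlam₁
  set lam₀' := topValue su2Rep L' β' with hlam₀'
  set lam₁' := secondValue su2Rep L' β' with hlam₁'
  set V := (l2 (fun U : GaugeConfig 3 (2 ^ k * L') FemtoTransferGap.SU2 => φ₁ (fun e : Edge 3 L' => transport U (torusBlockCorner (2 ^ k) L' e.1) (List.replicate (2 ^ k) e.2)) / φ₀ (fun e : Edge 3 L' => transport U (torusBlockCorner (2 ^ k) L' e.1) (List.replicate (2 ^ k) e.2)) * Ω U) (fun U : GaugeConfig 3 (2 ^ k * L') FemtoTransferGap.SU2 => φ₁ (fun e : Edge 3 L' => transport U (torusBlockCorner (2 ^ k) L' e.1) (List.replicate (2 ^ k) e.2)) / φ₀ (fun e : Edge 3 L' => transport U (torusBlockCorner (2 ^ k) L' e.1) (List.replicate (2 ^ k) e.2)) * Ω U) - l2 (fun U : GaugeConfig 3 (2 ^ k * L') FemtoTransferGap.SU2 => φ₁ (fun e : Edge 3 L' => transport U (torusBlockCorner (2 ^ k) L' e.1) (List.replicate (2 ^ k) e.2))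 / φ₀ (fun e : Edge 3 L' => transport U (torusBlockCorner (2 ^ k) L' e.1) (List.replicate (2 ^ k) e.2)) * Ω U) Ω ^ 2) with hV
  set Dm := (topValue su2Rep (2 ^ k * L') β ^ (2 ^ k) * l2 (fun U : GaugeConfig 3 (2 ^ k * L') FemtoTransferGap.SU2 => φ₁ (fun e : Edge 3 L' => transport U (torusBlockCorner (2 ^ k) L' e.1) (List.replicate (2 ^ k) e.2)) / φ₀ (fun e : Edge 3 L' => transport U (torusBlockCorner (2 ^ k) L' e.1) (List.replicate (2 ^ k) e.2)) * Ω U) (fun U : GaugeConfig 3 (2 ^ k * L') FemtoTransferGap.SU2 => φ₁ (fun e : Edge 3 L' => transport U (torusBlockCorner (2 ^ k) L' e.1) (List.replicate (2 ^ k) e.2)) / φ₀ (fun e : Edge 3 L' => transport U (torusBlockCorner (2 ^ k) L' e.1) (List.replicate (2 ^ k) e.2)) * Ω U) - l2 (fun U : GaugeConfig 3 (2 ^ k * L') FemtoTransferGap.SU2 => φ₁ (fun e : Edge 3 L' => transport U (torusBlockCorner (2 ^ k) L' e.1) (List.replicate (2 ^ k) e.2)) / φ₀ (fun e : Edge 3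 L' => transport U (torusBlockCorner (2 ^ k) L' e.1) (List.replicate (2 ^ k) e.2)) * Ω U) ((transferApply β)^[2 ^ k] (fun U : GaugeConfig 3 (2 ^ k * L') FemtoTransferGap.SU2 => φ₁ (fun e : Edge 3 L' => transport U (torusBlockCorner (2 ^ k) L' e.1) (List.replicate (2 ^ k) e.2)) / φ₀ (fun e : Edge 3 L' => transport U (torusBlockCorner (2 ^ k) L' e.1) (List.replicate (2 ^ k) e.2)) * Ω U))) with hDm
  have hlam₀'0 : 0 ≤ lam₀' := (topValue_su2Rep_pos L' β').le
  have hVL : 0 < V ^ L' := pow_pos hVpos L'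
  have hApow : (lam₀ ^ (2 ^ k) * V - Dm) ^ L' ≤ lam₁ ^ (2 ^ k * L') * V ^ L' := by
    calc (lam₀ ^ (2 ^ k) * V - Dm) ^ L' ≤ (lam₁ ^ (2 ^ k) * V) ^ L' := pow_le_pow_left₀ hA hdef L'
      _ = lam₁ ^ (2 ^ k * L') * V ^ L' := by rw [mul_pow, ← pow_mul]
  have key : lam₁' ^ L' * lam₀ ^ (2 ^ k * L') * V ^ L' ≤
      Real.exp (C * luscherLambda β (2 ^ k * L') ^ 2) * (lam₁ ^ (2 ^ k * L') * lam₀' ^ L') * V ^ L' := by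
    calc lam₁' ^ L' * lam₀ ^ (2 ^ k * L') * V ^ L' = lam₁' ^ L' * (lam₀ ^ (2 ^ k) * V) ^ L' := by rw [mul_pow, ← pow_mul]; ring
      _ ≤ Real.exp (C * luscherLambda β (2 ^ k * L') ^ 2) * (lam₀' ^ L' * (lam₀ ^ (2 ^ k) * V - Dm) ^ L') := hineq
      _ ≤ Real.exp (C * luscherLambda β (2 ^ k * L') ^ 2) * (lam₀' ^ L' * (lam₁ ^ (2 ^ k * L') * V ^ L')) :=
          mul_le_mul_of_nonneg_left (mul_le_mul_of_nonneg_left hApow (pow_nonneg hlam₀'0 _)) (Real.exp_pos _).le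
      _ = Real.exp (C * luscherLambda β (2 ^ k * L') ^ 2) * (lam₁ ^ (2 ^ k * L') * lam₀' ^ L') * V ^ L' := by ring
  exact le_of_mul_le_mul_right key hVL

end Summit.QuantumFields.YangMills.Theorems.FemtoCutoffLadder

end
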